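import Mathlib

/-!
# Crux-triage r1-3 certificates for `TwinTwistorTransport` (stmt-HodgeConjecture-14522)

Lean-checked cores of two findings of triager 3 (TRIAGE-r1-3.md):

* **F-B (parity).** The quadratic form of a symmetric integer matrix with even diagonal is even;
  the Kronecker (tensor) product of two such matrices is again such a matrix.  Hence
  `H²(X,ℤ) ⊗ H²(Y′,ℤ)` (tensor of two even K3 lattices) is an even lattice, and with the hyperbolic
  summand `⟨p, p′⟩` so is `H⁴(X × Y′, ℤ)`: every l.c.i. surface `Z ⊂ X × Y′` has `Z·Z` even.  With
  Riemann–Roch for the normal bundle (`Z·Z = 2χ(𝒪_Z) − 2h⁰(N_Z) + h¹(N_Z)`, using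
  `h²(N_Z) = h⁰(N_Z)` from `N^∨ ⊗ ω_Z ≅ N`), `h¹(N_Z)` is even — so a Bloch-semiregular l.c.i.
  carrier (for which `h¹(N_Z) = codim of the first-order Hodge locus`, F-A) cannot have codimension
  `21`, i.e. cannot carry the polarisation term `N(L ⊞ L′)²`.
* **F-D (empty small moduli at Pic-trivial nodes).** `χ(E) = 2r − c₂ = −h¹(E) ≤ 0` for a
  slope-stable `c₁ = 0` sheaf on an `NS = 0` K3 (`h⁰ = h² = 0`), so `c₂ ≥ 2r`; `v = (2,0,−1)`
  (`c₂ = 3`) is excluded.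

Only the linear-algebra / arithmetic skeletons are certified; the geometric identifications are in
TRIAGE-r1-3.md.  Refuter seat refuter-cruxtri-stmt-HodgeConjecture-14522-r1-3-0, 2026-08-15.
-/

namespace Summit.HodgeConjecture.HodgeConjecture.Cruxes.TwinTwistorTransport.Triage3

open Matrix

variable {n m : Type*}

/-- For a symmetric matrix the bilinear form `x ⬝ᵥ M *ᵥ y` is symmetric. -/
theorem dotProduct_mulVec_comm_of_isSymm [Fintype n] (M : Matrix n n ℤ) (hM : M.IsSymm)
    (x y : n → ℤ) : x ⬝ᵥ M *ᵥ y = y ⬝ᵥ M *ᵥ x := by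
  rw [dotProduct_mulVec, ← mulVec_transpose, hM.eq, dotProduct_comm]

/-- **F-B core.** A symmetric integer matrix with even diagonal has an EVEN quadratic form:
`x ⬝ᵥ M *ᵥ x ∈ 2ℤ` for every integer vector `x` (the form mod 2 is additive and vanishes on the
coordinate vectors). [folklore] -/
theorem even_dotProduct_mulVec_self [Fintype n] [DecidableEq n] (M : Matrix n n ℤ)
    (hM : M.IsSymm) (hd : ∀ i, Even (M i i)) (x : n → ℤ) : Even (x ⬝ᵥ M *ᵥ x) := by
  -- the quadratic form reduced mod 2, as an additive map
  let f : (n → ℤ) →+ ZMod 2 :=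
    { toFun := fun x => ((x ⬝ᵥ M *ᵥ x : ℤ) : ZMod 2)
      map_zero' := by simp
      map_add' := by
        intro x y
        have hs := dotProduct_mulVec_comm_of_isSymm M hM y x
        simp only [mulVec_add, dotProduct_add, add_dotProduct, hs]
        push_cast
        have h2 : ((x ⬝ᵥ M *ᵥ y : ℤ) : ZMod 2) + ((x ⬝ᵥ M *ᵥ y : ℤ) : ZMod 2) = 0 :=
          CharTwo.add_self_eq_zero _
        linear_combination h2 }
  have hf : f = 0 := by
    refine AddMonoidHom.functions_ext _ _ _ fun i k => ?_
    show (((Pi.single i k : n → ℤ) ⬝ᵥ M *ᵥ (Pi.single i k) : ℤ) : ZMod 2) = 0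
    have hval : (Pi.single i k : n → ℤ) ⬝ᵥ M *ᵥ (Pi.single i k) = k * (M i i * k) := by
      rw [single_dotProduct]
      congr 1
      simp [mulVec, dotProduct, Pi.single_apply]
    rw [hval, ZMod.intCast_zmod_eq_zero_iff_dvd]
    obtain ⟨a, ha⟩ := hd i
    exact ⟨k * a * k, by rw [ha]; ring⟩
  have hx : f x = 0 := by rw [hf]; rfl
  have hx' : (((x ⬝ᵥ M *ᵥ x : ℤ)) : ZMod 2) = 0 := hx
  rw [ZMod.intCast_zmod_eq_zero_iff_dvd] at hx'
  exact even_iff_two_dvd.mpr (by exact_mod_cast hx')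

/-- The Kronecker (tensor) product of symmetric matrices is symmetric. -/
theorem isSymm_kronecker {A : Matrix n n ℤ} {B : Matrix m m ℤ} (hA : A.IsSymm) (hB : B.IsSymm) :
    (kroneckerMap (· * ·) A B).IsSymm := by
  rw [Matrix.IsSymm, ← kroneckerMap_transpose, hA.eq, hB.eq]

/-- The Kronecker product of matrices with even diagonals has even diagonal. -/
theorem even_diag_kronecker {A : Matrix n n ℤ} {B : Matrix m m ℤ} (hA : ∀ i, Even (A i i))
    (ik : n × m) : Even (kroneckerMap (· * ·) A B ik ik) := by
  rw [kroneckerMap_apply]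
  exact (hA ik.1).mul_right _

/-- **F-B, tensor step.** The tensor product of two even lattices (symmetric Gram matrices with
even diagonal) is an even lattice. [folklore] -/
theorem even_form_kronecker [Fintype n] [DecidableEq n] [Fintype m] [DecidableEq m]
    {A : Matrix n n ℤ} {B : Matrix m m ℤ} (hA : A.IsSymm) (hB : B.IsSymm)
    (hAd : ∀ i, Even (A i i)) (x : n × m → ℤ) :
    Even (x ⬝ᵥ kroneckerMap (· * ·) A B *ᵥ x) :=
  even_dotProduct_mulVec_self _ (isSymm_kronecker hA hB) (even_diag_kronecker hAd) x

/-- **F-B, conclusion (arithmetic skeleton).** Riemann–Roch for the rank-2 normal bundle of an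
l.c.i. surface in a `K`-trivial fourfold gives `Z·Z = 2χ(𝒪_Z) − 2h⁰(N_Z) + h¹(N_Z)`; if `Z·Z` is
even then `h¹(N_Z)` is even — so it is never `21`. -/
theorem h1_normal_even {ZZ chi h0 h1 : ℤ} (hRR : ZZ = 2 * chi - 2 * h0 + h1) (hZZ : Even ZZ) :
    Even h1 ∧ h1 ≠ 21 := by
  obtain ⟨k, hk⟩ := hZZ
  refine ⟨⟨k - chi + h0, by omega⟩, by omega⟩

/-- **F-D (arithmetic skeleton).** On an `NS = 0` K3, a slope-stable sheaf with `c₁ = 0` has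
`h⁰ = h² = 0`, so `χ = 2r − c₂ = −h¹ ≤ 0`: `c₂ ≥ 2r`; in particular `(r, c₂) = (2, 3)`, i.e.
`v = (2,0,−1)`, does not occur. -/
theorem slice_c2_ge_twice_rank' {r c2 h1 : ℤ} (hchi : 2 * r - c2 = -h1) (hh1 : 0 ≤ h1) :
    2 * r ≤ c2 ∧ ¬ (r = 2 ∧ c2 = 3) := by
  refine ⟨by omega, by omega⟩

end Summit.HodgeConjecture.HodgeConjecture.Cruxes.TwinTwistorTransport.Triage3
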